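import Summits.QuantumFields.YangMills.Theorems.BalabanUVNodesSpineReadingOfRecord13CoPHKComponentSizeBlocksRatioDomination
import Summits.QuantumFields.YangMills.Theorems.BalabanUVNodesN20FinalLevelBankedBudget

/-!
# N20 (NE7b) ON THE TOWER-FREE ROAD AT THE CoPHK CARRIERS OF RECORD: for ANY bad-key reading, per-history fibrewise letters with GOOD images + the banked budget ⇒
# `RelWeightBound 1 (classSetK₁₃ …) (weightAK₁₃ …) (weightBK₁₃ …) (badClassK₁₃ … bd) (K ↦ 1 − exp(−C·V·r^{K − j⋆(K) + 1}∕(1 − r)))` — `0 ≤ W_K < 1` for every `K`, `Σ_K W_K < ∞`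
# from `0 < r < 1` and `c·K ≤ K − j⋆(K)`; rm ∕ φ ∕ hDom DISPLAYED

Cell `pub-ymgap`, YM-PLAN Track A (HUMAN RULING D-0062); seat `pub-ymgap-dag-n20-d` (R134 (a) N20 NE7b s3), gen 40 — director-ym №374 line (E), item (c) docked BY NAME at the lineage's coarse
keyed carriers.  Companions: `…N20FinalLevelBankedBudget` (gen 40: `sum_classWeightOfDatum₉_le_weightKP_mul_sum_of_fibreDom`, `relWeightBound_twoRate_of_weightKP_le`),
`…CoPHKComponentSizeBlocksRatioDomination` (gen 39, p768241: `sum_badK_weightAK₁₃_eq_sum_hist` ∕ `…BK…`, `sum_classSetK_weightAK₁₃_eq_sum_hist` ∕ `…BK…`), `…SpineReadingOfRecord13CoPHK`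
(`classSetK₁₃`, `weightAK₁₃ ∕ weightBK₁₃`, `badClassK₁₃`, `badClassK₁₃_subset`, `relWeightBound_crOfRecord₁₃KAt`).  `--kind proof --supports stmt-QuantumFields-27366 --as helper` (K3⁸);
COUNT-NEUTRAL; THEOREMS ONLY (0 `def`).  [IV] = [Balaban1989LargeFieldI]; [LF-II] = [Balaban1989LargeFieldII].

WHY.  Gen 39's `badMassA_le_of_fibreDom` reads the coarse bad mass of a run against the run's TOTAL with an abstract multiplicity `W`; on road [e] the multiplicity of the compatible
families is `exp(S) − 1` (p768103 §3), which is `< 1` only for `S < log 2`.  When the removal map lands in the GOOD coarse class (every offending old component removed — the natural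
removal), the same letter reads against the GOOD mass and turns into `1 − exp(−S)` against the total (`…N20FinalLevelBankedBudget` §1), `< 1` for every `S`; with the banked two-rate
budget `S_K = C·V·r^{K − j⋆(K) + 1}∕(1 − r)` of item (c) this is `RelWeightBound` at the coarse carriers for ANY bad-key reading `bd`, with NO schedule numerics beyond `0 < r < 1`,
`C, V ≥ 0`, `c·K ≤ K − j⋆(K)` — the weight of `T4HistoryPeeling.relWeightBound_of_slotDom_twoRate` ∕ `T4PersistenceRenewal.relWeightBound_of_fibreRate`, now fed by fibrewise letters at the
final level instead of single-slot class-level ratio bounds.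

WHAT IS PROVED (kernel; bookkeeping over the companions).  §1 ★★ `badMassA_le_weightKP_of_fibreDom` ∕ `badMassB_le_weightKP_of_fibreDom`: at `(K, t)`, ANY `bd`: a removal map on the run's
final-level histories sending bad-key histories to GOOD-key histories, fibre sets, factors, the fibrewise letter on the bad-key histories, the fibre injections into slot-filed stocks
with `z ≤ Π x`, `Σ_{Old σ} x ≤ S`, displayed measurability ∕ integrability (non-negativity BY NAME from `hP`) ⇒ `Σ_{bad} weightAK ≤ (1 − exp(−S))·Σ weightAK`.  §2 ★★★
`relWeightBound_twoRate_of_fibreDomLetters_banked`: both runs' data per `(K, t)`, `|t| ≤ 1` (existentially displayed) with the budget `S_K` ⇒ `RelWeightBound 1 … (K ↦ 1 − exp(−S_K))`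
(transport to the keyed-dial spine reading of record `crOfRecord₁₃KAt K₀ kr bd sh` is gen 29's one-liner `relWeightBound_crOfRecord₁₃KAt`).

HONEST FRAMING.  [bookkeeping].  hDom is a HYPOTHESIS (an ESTIMATE — [LF-II] (1.79)∕(1.89)⁺'s KIND on [IV] (0.3)'s fibre ratio; junction NC-NE7b-α UNRULED); the removal maps, fibre
injections and slot-filed stocks are DATA (a DEFINER object on def-T's index; post-campaign design memo per №374); the budget `Σ_{Old σ} x ≤ S_K` is item (c)'s conclusion shape
(`sum_stock_le_twoRate_of_slotPrices ∕ _of_uniformWindow ∕ _of_records` supply it from banked renewal credits — the cell's R1, NOT PRINTED).  Whether a given bad-key reading `bd` serves U5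
is the planners' reading.  NO weight of Bałaban's is bounded, NO estimate proved; NE7 ∕ NE7b ∕ NE7c NOT PRINTED for `d = 4` ∕ NOT proved; no `Provisos₁₃CoPH` inhabitant claimed (K0⁷ OPEN);
K3⁸ untouched; N20 NOT discharged; counts UNMOVED (typed 28∕28 · discharged 8∕27); one finite four-torus programme at fixed `ε` — NOT ℝ⁴, NOT OS, NOT a mass gap, NOT the Clay problem.  No
`def`, no `instance`, no `notation`, no `sorry`; no decl below carries a cite tag.
-/

noncomputable section

open MeasureTheory
open scoped BigOperators
open Finset

namespace YMDAG.UVSplit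

open Literature.MathematicalPhysics.QuantumFieldTheory.Balaban1983to89
open Literature.MathematicalPhysics.QuantumFieldTheory.Balaban1983to89.T4Continuum
open Literature.MathematicalPhysics.QuantumFieldTheory.Balaban1983to89.Node00
open Literature.MathematicalPhysics.QuantumFieldTheory.Balaban1983to89.B15.BasicStep (fibreIntegral)
open T4WeightBudget (RelWeightBound)
open Summit.QuantumFields.YangMills.BalabanUVNodes.N19MGFRoadLiveSelectorTower (dressedSlotsOfDatum₉_nonneg)
open Summit.QuantumFields.YangMills.BalabanUVNodes.N21KeyedShellWeightShellZero (wOfRecord₉_nonneg_of_provisos₁₃CoPH)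

variable {F : T4Family} {N : ℕ} [NeZero N]

/-! ## §1 A coarse bad class, any reading, weighs ≤ 1 − exp(−S) of the run's total: fibrewise letter with GOOD images + the budget -/

section Letters

variable (θ : Stage13HParams F N) (hP : θ.Provisos₁₃CoPH F N) (K₀ : ℕ) (g₀ : ℕ → ℝ) (os : List (ULoop F))
  (kr : ℕ → (Σ K, SiteSeqKey F (K₀ + K)) → (Σ K, SiteSeqKey F (K₀ + K))) (bd : ℕ → (Σ K, SiteSeqKey F (K₀ + K)) → Prop)

open scoped Classical in
/-- ★★ **RUN A's COARSE BAD MASS IN THE KP SHAPE.**  At `(K, t)`, for ANY bad-key reading `bd`: a removal map `rm` on run A's level-`K₀+K` histories sending every history whose coarse key is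
bad to one whose coarse key is NOT bad, fibre sets `fib`, factors `z` with the letter hDom on the bad-key histories, fibre injections `φ σ` into the non-empty sub-families of stocks `Old σ`
with `z s ≤ Π_{Y ∈ φ σ s} x Y` (`0 ≤ x`) and the budget `Σ_{Y ∈ Old σ} x Y ≤ S`, plus the displayed measurability ∕ integrability of the dressed pieces ⇒
`Σ_{u ∈ badClassK} weightAK u ≤ (1 − exp(−S)) · Σ_{u ∈ classSetK} weightAK u`. [bookkeeping] -/
theorem badMassA_le_weightKP_of_fibreDom {X : Type*} (K : ℕ) (t : ℝ)
    (rm : SeqOfRecord F θ.ν θ.τ9.M (histA₁₃ θ K₀ g₀ K) (K₀ + K) (K₀ + K) → SeqOfRecord F θ.ν θ.τ9.M (histA₁₃ θ K₀ g₀ K) (K₀ + K) (K₀ + K))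
    (fib : SeqOfRecord F θ.ν θ.τ9.M (histA₁₃ θ K₀ g₀ K) (K₀ + K) (K₀ + K) → Finset (PBond (F.P (K₀ + K)) (K₀ + K)))
    (z : SeqOfRecord F θ.ν θ.τ9.M (histA₁₃ θ K₀ g₀ K) (K₀ + K) (K₀ + K) → ℝ)
    (hm : ∀ s, Measurable fun V => chiSeqOfRecord F N θ.ν θ.τ9.M (histA₁₃ θ K₀ g₀ K) (K₀ + K) (K₀ + K) s V *
      dressedSlotsOfDatum₉ F N θ.toStage9Params (datumOfRecord₁₃CoPH F N θ hP) g₀ os t (runA₁₃ F K₀ g₀ K) (histA₁₃ θ K₀ g₀ K) (K₀ + K) s V)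
    (hint : ∀ s, Integrable (fun V => chiSeqOfRecord F N θ.ν θ.τ9.M (histA₁₃ θ K₀ g₀ K) (K₀ + K) (K₀ + K) s V *
      dressedSlotsOfDatum₉ F N θ.toStage9Params (datumOfRecord₁₃CoPH F N θ hP) g₀ os t (runA₁₃ F K₀ g₀ K) (histA₁₃ θ K₀ g₀ K) (K₀ + K) s V)
      (fieldMeasure (F.P (K₀ + K)) (K₀ + K) (SU N)))
    (hDom : ∀ s, kr K (keyA₁₃ θ K₀ g₀ K s) ∈ badClassK₁₃ θ K₀ g₀ kr bd K t → ∀ V,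
      fibreIntegral (fib s) (fun V => chiSeqOfRecord F N θ.ν θ.τ9.M (histA₁₃ θ K₀ g₀ K) (K₀ + K) (K₀ + K) s V *
          dressedSlotsOfDatum₉ F N θ.toStage9Params (datumOfRecord₁₃CoPH F N θ hP) g₀ os t (runA₁₃ F K₀ g₀ K) (histA₁₃ θ K₀ g₀ K) (K₀ + K) s V) V ≤
        z s * fibreIntegral (fib s) (fun V => chiSeqOfRecord F N θ.ν θ.τ9.M (histA₁₃ θ K₀ g₀ K) (K₀ + K) (K₀ + K) (rm s) V *
          dressedSlotsOfDatum₉ F N θ.toStage9Params (datumOfRecord₁₃CoPH F N θ hP) g₀ os t (runA₁₃ F K₀ g₀ K) (histA₁₃ θ K₀ g₀ K) (K₀ + K) (rm s) V) V)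
    (hgood : ∀ s, kr K (keyA₁₃ θ K₀ g₀ K s) ∈ badClassK₁₃ θ K₀ g₀ kr bd K t → kr K (keyA₁₃ θ K₀ g₀ K (rm s)) ∉ badClassK₁₃ θ K₀ g₀ kr bd K t)
    (Old : SeqOfRecord F θ.ν θ.τ9.M (histA₁₃ θ K₀ g₀ K) (K₀ + K) (K₀ + K) → Finset X)
    (φ : SeqOfRecord F θ.ν θ.τ9.M (histA₁₃ θ K₀ g₀ K) (K₀ + K) (K₀ + K) → SeqOfRecord F θ.ν θ.τ9.M (histA₁₃ θ K₀ g₀ K) (K₀ + K) (K₀ + K) → Finset X) (x : X → ℝ) {S : ℝ}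
    (hx : ∀ σ, ∀ Y ∈ Old σ, 0 ≤ x Y)
    (hφ : ∀ σ s, kr K (keyA₁₃ θ K₀ g₀ K s) ∈ badClassK₁₃ θ K₀ g₀ kr bd K t → rm s = σ → φ σ s ⊆ Old σ ∧ (φ σ s).Nonempty)
    (hinj : ∀ σ, Set.InjOn (φ σ) {s | kr K (keyA₁₃ θ K₀ g₀ K s) ∈ badClassK₁₃ θ K₀ g₀ kr bd K t ∧ rm s = σ})
    (hz : ∀ σ s, kr K (keyA₁₃ θ K₀ g₀ K s) ∈ badClassK₁₃ θ K₀ g₀ kr bd K t → rm s = σ → z s ≤ ∏ Y ∈ φ σ s, x Y) (hS : ∀ σ, ∑ Y ∈ Old σ, x Y ≤ S) :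
    ∑ u ∈ badClassK₁₃ θ K₀ g₀ kr bd K t, weightAK₁₃ θ hP K₀ g₀ os kr K t u ≤ (1 - Real.exp (-S)) * ∑ u ∈ classSetK₁₃ θ K₀ g₀ kr K, weightAK₁₃ θ hP K₀ g₀ os kr K t u := by
  rw [sum_badK_weightAK₁₃_eq_sum_hist, sum_classSetK_weightAK₁₃_eq_sum_hist]
  have h0 : ∀ s V, 0 ≤ chiSeqOfRecord F N θ.ν θ.τ9.M (histA₁₃ θ K₀ g₀ K) (K₀ + K) (K₀ + K) s V *
      dressedSlotsOfDatum₉ F N θ.toStage9Params (datumOfRecord₁₃CoPH F N θ hP) g₀ os t (runA₁₃ F K₀ g₀ K) (histA₁₃ θ K₀ g₀ K) (K₀ + K) s V :=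
    fun s V => mul_nonneg (chiSeqOfRecord_nonneg F N θ.ν θ.τ9.M _ _ _ s V)
      (dressedSlotsOfDatum₉_nonneg F N θ.toStage9Params (datumOfRecord₁₃CoPH F N θ hP) g₀ os (runA₁₃ F K₀ g₀ K) (histA₁₃ θ K₀ g₀ K)
        (wOfRecord₉_nonneg_of_provisos₁₃CoPH F θ hP (runA₁₃ F K₀ g₀ K) (histA₁₃ θ K₀ g₀ K)) t (K₀ + K) s V)
  have hmemB : ∀ s, s ∈ Finset.univ.filter (fun s => kr K (keyA₁₃ θ K₀ g₀ K s) ∈ badClassK₁₃ θ K₀ g₀ kr bd K t) ↔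
      kr K (keyA₁₃ θ K₀ g₀ K s) ∈ badClassK₁₃ θ K₀ g₀ kr bd K t := fun s => by simp only [Finset.mem_filter, Finset.mem_univ, true_and]
  have hmemF : ∀ σ s, s ∈ (Finset.univ.filter (fun s => kr K (keyA₁₃ θ K₀ g₀ K s) ∈ badClassK₁₃ θ K₀ g₀ kr bd K t)).filter (fun s => rm s = σ) ↔
      kr K (keyA₁₃ θ K₀ g₀ K s) ∈ badClassK₁₃ θ K₀ g₀ kr bd K t ∧ rm s = σ := fun σ s => by simp only [Finset.mem_filter, Finset.mem_univ, true_and]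
  refine sum_classWeightOfDatum₉_le_weightKP_mul_sum_of_fibreDom θ.toStage9Params (datumOfRecord₁₃CoPH F N θ hP) g₀ os (runA₁₃ F K₀ g₀ K) (histA₁₃ θ K₀ g₀ K)
    (K₀ + K) t _ rm fib z hm h0 hint (fun s hs => hDom s ((hmemB s).1 hs)) (fun s hs h' => hgood s ((hmemB s).1 hs) ((hmemB _).1 h')) Old φ x hx
    (fun σ s hs => hφ σ s ((hmemF σ s).1 hs).1 ((hmemF σ s).1 hs).2) (fun σ => (hinj σ).mono fun s hs => (hmemF σ s).1 hs)
    (fun σ s hs => hz σ s ((hmemF σ s).1 hs).1 ((hmemF σ s).1 hs).2) hS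

open scoped Classical in
/-- ★★ **RUN B's COARSE BAD MASS IN THE KP SHAPE**, likewise on the level-`K₀+K+1` histories of run B. [bookkeeping] -/
theorem badMassB_le_weightKP_of_fibreDom {X : Type*} (K : ℕ) (t : ℝ)
    (rm : SeqOfRecord F θ.ν θ.τ9.M (histB₁₃ θ K₀ g₀ K) (K₀ + K + 1) (K₀ + K + 1) → SeqOfRecord F θ.ν θ.τ9.M (histB₁₃ θ K₀ g₀ K) (K₀ + K + 1) (K₀ + K + 1))
    (fib : SeqOfRecord F θ.ν θ.τ9.M (histB₁₃ θ K₀ g₀ K) (K₀ + K + 1) (K₀ + K + 1) → Finset (PBond (F.P (K₀ + K + 1)) (K₀ + K + 1)))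
    (z : SeqOfRecord F θ.ν θ.τ9.M (histB₁₃ θ K₀ g₀ K) (K₀ + K + 1) (K₀ + K + 1) → ℝ)
    (hm : ∀ s', Measurable fun V => chiSeqOfRecord F N θ.ν θ.τ9.M (histB₁₃ θ K₀ g₀ K) (K₀ + K + 1) (K₀ + K + 1) s' V *
      dressedSlotsOfDatum₉ F N θ.toStage9Params (datumOfRecord₁₃CoPH F N θ hP) g₀ os t (runB₁₃ F K₀ g₀ K) (histB₁₃ θ K₀ g₀ K) (K₀ + K + 1) s' V)
    (hint : ∀ s', Integrable (fun V => chiSeqOfRecord F N θ.ν θ.τ9.M (histB₁₃ θ K₀ g₀ K) (K₀ + K + 1) (K₀ + K + 1) s' V *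
      dressedSlotsOfDatum₉ F N θ.toStage9Params (datumOfRecord₁₃CoPH F N θ hP) g₀ os t (runB₁₃ F K₀ g₀ K) (histB₁₃ θ K₀ g₀ K) (K₀ + K + 1) s' V)
      (fieldMeasure (F.P (K₀ + K + 1)) (K₀ + K + 1) (SU N)))
    (hDom : ∀ s', kr K (keyB₁₃ θ K₀ g₀ K s') ∈ badClassK₁₃ θ K₀ g₀ kr bd K t → ∀ V,
      fibreIntegral (fib s') (fun V => chiSeqOfRecord F N θ.ν θ.τ9.M (histB₁₃ θ K₀ g₀ K) (K₀ + K + 1) (K₀ + K + 1) s' V *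
          dressedSlotsOfDatum₉ F N θ.toStage9Params (datumOfRecord₁₃CoPH F N θ hP) g₀ os t (runB₁₃ F K₀ g₀ K) (histB₁₃ θ K₀ g₀ K) (K₀ + K + 1) s' V) V ≤
        z s' * fibreIntegral (fib s') (fun V => chiSeqOfRecord F N θ.ν θ.τ9.M (histB₁₃ θ K₀ g₀ K) (K₀ + K + 1) (K₀ + K + 1) (rm s') V *
          dressedSlotsOfDatum₉ F N θ.toStage9Params (datumOfRecord₁₃CoPH F N θ hP) g₀ os t (runB₁₃ F K₀ g₀ K) (histB₁₃ θ K₀ g₀ K) (K₀ + K + 1) (rm s') V) V)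
    (hgood : ∀ s', kr K (keyB₁₃ θ K₀ g₀ K s') ∈ badClassK₁₃ θ K₀ g₀ kr bd K t → kr K (keyB₁₃ θ K₀ g₀ K (rm s')) ∉ badClassK₁₃ θ K₀ g₀ kr bd K t)
    (Old : SeqOfRecord F θ.ν θ.τ9.M (histB₁₃ θ K₀ g₀ K) (K₀ + K + 1) (K₀ + K + 1) → Finset X)
    (φ : SeqOfRecord F θ.ν θ.τ9.M (histB₁₃ θ K₀ g₀ K) (K₀ + K + 1) (K₀ + K + 1) → SeqOfRecord F θ.ν θ.τ9.M (histB₁₃ θ K₀ g₀ K) (K₀ + K + 1) (K₀ + K + 1) → Finset X)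
    (x : X → ℝ) {S : ℝ} (hx : ∀ σ, ∀ Y ∈ Old σ, 0 ≤ x Y)
    (hφ : ∀ σ s', kr K (keyB₁₃ θ K₀ g₀ K s') ∈ badClassK₁₃ θ K₀ g₀ kr bd K t → rm s' = σ → φ σ s' ⊆ Old σ ∧ (φ σ s').Nonempty)
    (hinj : ∀ σ, Set.InjOn (φ σ) {s' | kr K (keyB₁₃ θ K₀ g₀ K s') ∈ badClassK₁₃ θ K₀ g₀ kr bd K t ∧ rm s' = σ})
    (hz : ∀ σ s', kr K (keyB₁₃ θ K₀ g₀ K s') ∈ badClassK₁₃ θ K₀ g₀ kr bd K t → rm s' = σ → z s' ≤ ∏ Y ∈ φ σ s', x Y) (hS : ∀ σ, ∑ Y ∈ Old σ, x Y ≤ S) :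
    ∑ u ∈ badClassK₁₃ θ K₀ g₀ kr bd K t, weightBK₁₃ θ hP K₀ g₀ os kr K t u ≤ (1 - Real.exp (-S)) * ∑ u ∈ classSetK₁₃ θ K₀ g₀ kr K, weightBK₁₃ θ hP K₀ g₀ os kr K t u := by
  rw [sum_badK_weightBK₁₃_eq_sum_hist, sum_classSetK_weightBK₁₃_eq_sum_hist]
  have h0 : ∀ s' V, 0 ≤ chiSeqOfRecord F N θ.ν θ.τ9.M (histB₁₃ θ K₀ g₀ K) (K₀ + K + 1) (K₀ + K + 1) s' V *
      dressedSlotsOfDatum₉ F N θ.toStage9Params (datumOfRecord₁₃CoPH F N θ hP) g₀ os t (runB₁₃ F K₀ g₀ K) (histB₁₃ θ K₀ g₀ K) (K₀ + K + 1) s' V :=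
    fun s' V => mul_nonneg (chiSeqOfRecord_nonneg F N θ.ν θ.τ9.M _ _ _ s' V)
      (dressedSlotsOfDatum₉_nonneg F N θ.toStage9Params (datumOfRecord₁₃CoPH F N θ hP) g₀ os (runB₁₃ F K₀ g₀ K) (histB₁₃ θ K₀ g₀ K)
        (wOfRecord₉_nonneg_of_provisos₁₃CoPH F θ hP (runB₁₃ F K₀ g₀ K) (histB₁₃ θ K₀ g₀ K)) t (K₀ + K + 1) s' V)
  have hmemB : ∀ s', s' ∈ Finset.univ.filter (fun s' => kr K (keyB₁₃ θ K₀ g₀ K s') ∈ badClassK₁₃ θ K₀ g₀ kr bd K t) ↔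
      kr K (keyB₁₃ θ K₀ g₀ K s') ∈ badClassK₁₃ θ K₀ g₀ kr bd K t := fun s' => by simp only [Finset.mem_filter, Finset.mem_univ, true_and]
  have hmemF : ∀ σ s', s' ∈ (Finset.univ.filter (fun s' => kr K (keyB₁₃ θ K₀ g₀ K s') ∈ badClassK₁₃ θ K₀ g₀ kr bd K t)).filter (fun s' => rm s' = σ) ↔
      kr K (keyB₁₃ θ K₀ g₀ K s') ∈ badClassK₁₃ θ K₀ g₀ kr bd K t ∧ rm s' = σ := fun σ s' => by simp only [Finset.mem_filter, Finset.mem_univ, true_and]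
  refine sum_classWeightOfDatum₉_le_weightKP_mul_sum_of_fibreDom θ.toStage9Params (datumOfRecord₁₃CoPH F N θ hP) g₀ os (runB₁₃ F K₀ g₀ K) (histB₁₃ θ K₀ g₀ K)
    (K₀ + K + 1) t _ rm fib z hm h0 hint (fun s hs => hDom s ((hmemB s).1 hs)) (fun s hs h' => hgood s ((hmemB s).1 hs) ((hmemB _).1 h')) Old φ x hx
    (fun σ s hs => hφ σ s ((hmemF σ s).1 hs).1 ((hmemF σ s).1 hs).2) (fun σ => (hinj σ).mono fun s hs => (hmemF σ s).1 hs)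
    (fun σ s hs => hz σ s ((hmemF σ s).1 hs).1 ((hmemF σ s).1 hs).2) hS

end Letters

/-! ## §2 The face: `RelWeightBound` at the coarse carriers with the banked two-rate weight, any bad-key reading -/

section Face

variable (θ : Stage13HParams F N) (hP : θ.Provisos₁₃CoPH F N) (K₀ : ℕ) (g₀ : ℕ → ℝ) (os : List (ULoop F))
  (kr : ℕ → (Σ K, SiteSeqKey F (K₀ + K)) → (Σ K, SiteSeqKey F (K₀ + K))) (bd : ℕ → (Σ K, SiteSeqKey F (K₀ + K)) → Prop)

open scoped Classical in
/-- ★★★ **THE N20 FACE ON THE TOWER-FREE ROAD WITH THE BANKED BUDGET, ANY BAD-KEY READING.**  Constants `C, V ≥ 0`, `0 < r < 1`, an age cut `j⋆` keeping a positive fraction of the steps old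
(`c·K ≤ K − j⋆(K)`); for every `(K, t)` with `|t| ≤ 1`, EACH RUN supplies the data of road [e] — a removal map on its final-level histories sending bad-key histories to good-key ones, fibre
sets, factors with the fibrewise letter on the bad-key histories, fibre injections into slot-filed stocks with multiplicative majorants and the budget `Σ_{Old σ} x ≤ S_K`,
`S_K = C·V·r^{K − j⋆(K) + 1}∕(1 − r)` (item (c)) — together with the displayed measurability ∕ integrability of the dressed pieces ⇒
`RelWeightBound 1 (classSetK₁₃ …) (weightAK₁₃ …) (weightBK₁₃ …) (badClassK₁₃ … bd) (K ↦ 1 − exp(−S_K))`: `0 ≤ W_K < 1` for every `K` and `Σ_K W_K < ∞` with NO further numerics. [bookkeeping] -/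
theorem relWeightBound_twoRate_of_fibreDomLetters_banked {X : Type*} {C V r c : ℝ} (hC : 0 ≤ C) (hV : 0 ≤ V) (h0 : 0 < r) (h1 : r < 1) (hc : 0 < c)
    {jstar : ℕ → ℕ} (hfrac : ∀ K : ℕ, c * K ≤ ((K - jstar K : ℕ) : ℝ))
    (hmA : ∀ K t s, Measurable fun V => chiSeqOfRecord F N θ.ν θ.τ9.M (histA₁₃ θ K₀ g₀ K) (K₀ + K) (K₀ + K) s V *
      dressedSlotsOfDatum₉ F N θ.toStage9Params (datumOfRecord₁₃CoPH F N θ hP) g₀ os t (runA₁₃ F K₀ g₀ K) (histA₁₃ θ K₀ g₀ K) (K₀ + K) s V)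
    (hintA : ∀ K t s, Integrable (fun V => chiSeqOfRecord F N θ.ν θ.τ9.M (histA₁₃ θ K₀ g₀ K) (K₀ + K) (K₀ + K) s V *
      dressedSlotsOfDatum₉ F N θ.toStage9Params (datumOfRecord₁₃CoPH F N θ hP) g₀ os t (runA₁₃ F K₀ g₀ K) (histA₁₃ θ K₀ g₀ K) (K₀ + K) s V)
      (fieldMeasure (F.P (K₀ + K)) (K₀ + K) (SU N)))
    (hmB : ∀ K t s', Measurable fun V => chiSeqOfRecord F N θ.ν θ.τ9.M (histB₁₃ θ K₀ g₀ K) (K₀ + K + 1) (K₀ + K + 1) s' V *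
      dressedSlotsOfDatum₉ F N θ.toStage9Params (datumOfRecord₁₃CoPH F N θ hP) g₀ os t (runB₁₃ F K₀ g₀ K) (histB₁₃ θ K₀ g₀ K) (K₀ + K + 1) s' V)
    (hintB : ∀ K t s', Integrable (fun V => chiSeqOfRecord F N θ.ν θ.τ9.M (histB₁₃ θ K₀ g₀ K) (K₀ + K + 1) (K₀ + K + 1) s' V *
      dressedSlotsOfDatum₉ F N θ.toStage9Params (datumOfRecord₁₃CoPH F N θ hP) g₀ os t (runB₁₃ F K₀ g₀ K) (histB₁₃ θ K₀ g₀ K) (K₀ + K + 1) s' V)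
      (fieldMeasure (F.P (K₀ + K + 1)) (K₀ + K + 1) (SU N)))
    (hLA : ∀ (K : ℕ) (t : ℝ), |t| ≤ 1 →
      ∃ (rm : SeqOfRecord F θ.ν θ.τ9.M (histA₁₃ θ K₀ g₀ K) (K₀ + K) (K₀ + K) → SeqOfRecord F θ.ν θ.τ9.M (histA₁₃ θ K₀ g₀ K) (K₀ + K) (K₀ + K))
        (fib : SeqOfRecord F θ.ν θ.τ9.M (histA₁₃ θ K₀ g₀ K) (K₀ + K) (K₀ + K) → Finset (PBond (F.P (K₀ + K)) (K₀ + K)))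
        (z : SeqOfRecord F θ.ν θ.τ9.M (histA₁₃ θ K₀ g₀ K) (K₀ + K) (K₀ + K) → ℝ)
        (Old : SeqOfRecord F θ.ν θ.τ9.M (histA₁₃ θ K₀ g₀ K) (K₀ + K) (K₀ + K) → Finset X)
        (φ : SeqOfRecord F θ.ν θ.τ9.M (histA₁₃ θ K₀ g₀ K) (K₀ + K) (K₀ + K) → SeqOfRecord F θ.ν θ.τ9.M (histA₁₃ θ K₀ g₀ K) (K₀ + K) (K₀ + K) → Finset X) (x : X → ℝ),
        (∀ s, kr K (keyA₁₃ θ K₀ g₀ K s) ∈ badClassK₁₃ θ K₀ g₀ kr bd K t → ∀ V,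
          fibreIntegral (fib s) (fun V => chiSeqOfRecord F N θ.ν θ.τ9.M (histA₁₃ θ K₀ g₀ K) (K₀ + K) (K₀ + K) s V *
              dressedSlotsOfDatum₉ F N θ.toStage9Params (datumOfRecord₁₃CoPH F N θ hP) g₀ os t (runA₁₃ F K₀ g₀ K) (histA₁₃ θ K₀ g₀ K) (K₀ + K) s V) V ≤
            z s * fibreIntegral (fib s) (fun V => chiSeqOfRecord F N θ.ν θ.τ9.M (histA₁₃ θ K₀ g₀ K) (K₀ + K) (K₀ + K) (rm s) V *
              dressedSlotsOfDatum₉ F N θ.toStage9Params (datumOfRecord₁₃CoPH F N θ hP) g₀ os t (runA₁₃ F K₀ g₀ K) (histA₁₃ θ K₀ g₀ K) (K₀ + K) (rm s) V) V) ∧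
        (∀ s, kr K (keyA₁₃ θ K₀ g₀ K s) ∈ badClassK₁₃ θ K₀ g₀ kr bd K t → kr K (keyA₁₃ θ K₀ g₀ K (rm s)) ∉ badClassK₁₃ θ K₀ g₀ kr bd K t) ∧
        (∀ σ, ∀ Y ∈ Old σ, 0 ≤ x Y) ∧
        (∀ σ s, kr K (keyA₁₃ θ K₀ g₀ K s) ∈ badClassK₁₃ θ K₀ g₀ kr bd K t → rm s = σ → φ σ s ⊆ Old σ ∧ (φ σ s).Nonempty) ∧
        (∀ σ, Set.InjOn (φ σ) {s | kr K (keyA₁₃ θ K₀ g₀ K s) ∈ badClassK₁₃ θ K₀ g₀ kr bd K t ∧ rm s = σ}) ∧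
        (∀ σ s, kr K (keyA₁₃ θ K₀ g₀ K s) ∈ badClassK₁₃ θ K₀ g₀ kr bd K t → rm s = σ → z s ≤ ∏ Y ∈ φ σ s, x Y) ∧
        (∀ σ, ∑ Y ∈ Old σ, x Y ≤ C * V * (r ^ (K - jstar K + 1) / (1 - r))))
    (hLB : ∀ (K : ℕ) (t : ℝ), |t| ≤ 1 →
      ∃ (rm : SeqOfRecord F θ.ν θ.τ9.M (histB₁₃ θ K₀ g₀ K) (K₀ + K + 1) (K₀ + K + 1) → SeqOfRecord F θ.ν θ.τ9.M (histB₁₃ θ K₀ g₀ K) (K₀ + K + 1) (K₀ + K + 1))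
        (fib : SeqOfRecord F θ.ν θ.τ9.M (histB₁₃ θ K₀ g₀ K) (K₀ + K + 1) (K₀ + K + 1) → Finset (PBond (F.P (K₀ + K + 1)) (K₀ + K + 1)))
        (z : SeqOfRecord F θ.ν θ.τ9.M (histB₁₃ θ K₀ g₀ K) (K₀ + K + 1) (K₀ + K + 1) → ℝ)
        (Old : SeqOfRecord F θ.ν θ.τ9.M (histB₁₃ θ K₀ g₀ K) (K₀ + K + 1) (K₀ + K + 1) → Finset X)
        (φ : SeqOfRecord F θ.ν θ.τ9.M (histB₁₃ θ K₀ g₀ K) (K₀ + K + 1) (K₀ + K + 1) → SeqOfRecord F θ.ν θ.τ9.M (histB₁₃ θ K₀ g₀ K) (K₀ + K + 1) (K₀ + K + 1) → Finset X)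
        (x : X → ℝ),
        (∀ s', kr K (keyB₁₃ θ K₀ g₀ K s') ∈ badClassK₁₃ θ K₀ g₀ kr bd K t → ∀ V,
          fibreIntegral (fib s') (fun V => chiSeqOfRecord F N θ.ν θ.τ9.M (histB₁₃ θ K₀ g₀ K) (K₀ + K + 1) (K₀ + K + 1) s' V *
              dressedSlotsOfDatum₉ F N θ.toStage9Params (datumOfRecord₁₃CoPH F N θ hP) g₀ os t (runB₁₃ F K₀ g₀ K) (histB₁₃ θ K₀ g₀ K) (K₀ + K + 1) s' V) V ≤
            z s' * fibreIntegral (fib s') (fun V => chiSeqOfRecord F N θ.ν θ.τ9.M (histB₁₃ θ K₀ g₀ K) (K₀ + K + 1) (K₀ + K + 1) (rm s') V *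
              dressedSlotsOfDatum₉ F N θ.toStage9Params (datumOfRecord₁₃CoPH F N θ hP) g₀ os t (runB₁₃ F K₀ g₀ K) (histB₁₃ θ K₀ g₀ K) (K₀ + K + 1) (rm s') V) V) ∧
        (∀ s', kr K (keyB₁₃ θ K₀ g₀ K s') ∈ badClassK₁₃ θ K₀ g₀ kr bd K t → kr K (keyB₁₃ θ K₀ g₀ K (rm s')) ∉ badClassK₁₃ θ K₀ g₀ kr bd K t) ∧
        (∀ σ, ∀ Y ∈ Old σ, 0 ≤ x Y) ∧
        (∀ σ s', kr K (keyB₁₃ θ K₀ g₀ K s') ∈ badClassK₁₃ θ K₀ g₀ kr bd K t → rm s' = σ → φ σ s' ⊆ Old σ ∧ (φ σ s').Nonempty) ∧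
        (∀ σ, Set.InjOn (φ σ) {s' | kr K (keyB₁₃ θ K₀ g₀ K s') ∈ badClassK₁₃ θ K₀ g₀ kr bd K t ∧ rm s' = σ}) ∧
        (∀ σ s', kr K (keyB₁₃ θ K₀ g₀ K s') ∈ badClassK₁₃ θ K₀ g₀ kr bd K t → rm s' = σ → z s' ≤ ∏ Y ∈ φ σ s', x Y) ∧
        (∀ σ, ∑ Y ∈ Old σ, x Y ≤ C * V * (r ^ (K - jstar K + 1) / (1 - r)))) :
    RelWeightBound 1 (classSetK₁₃ θ K₀ g₀ kr) (weightAK₁₃ θ hP K₀ g₀ os kr) (weightBK₁₃ θ hP K₀ g₀ os kr) (badClassK₁₃ θ K₀ g₀ kr bd)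
      (fun K => 1 - Real.exp (-(C * V * (r ^ (K - jstar K + 1) / (1 - r))))) := by
  refine relWeightBound_twoRate_of_weightKP_le hC hV h0 h1 hc hfrac (fun K t _ => badClassK₁₃_subset θ K₀ g₀ kr bd K t) ?_ ?_
  · intro K t ht
    obtain ⟨rm, fib, z, Old, φ, x, hDom, hgood, hx, hφ, hinj, hz, hS⟩ := hLA K t ht
    exact badMassA_le_weightKP_of_fibreDom θ hP K₀ g₀ os kr bd K t rm fib z (hmA K t) (hintA K t) hDom hgood Old φ x hx hφ hinj hz hS
  · intro K t ht
    obtain ⟨rm, fib, z, Old, φ, x, hDom, hgood, hx, hφ, hinj, hz, hS⟩ := hLB K t ht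
    exact badMassB_le_weightKP_of_fibreDom θ hP K₀ g₀ os kr bd K t rm fib z (hmB K t) (hintB K t) hDom hgood Old φ x hx hφ hinj hz hS

end Face

end YMDAG.UVSplit
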